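import Mathlib

/-!
# Derivative bounds on compact subsets from the local a priori estimate

Crux `WitnessCharge` (item stmt-SmoothPoincare4-7824, route SullivanDual), line `Sketch`, stub
`helper_derivBoundsLocal_of` (part of discharging the elliptic-regularity named fact
`JHolomorphicWeierstrassR4`).

**Statement.** Assume the LOCAL A PRIORI ESTIMATE on the unit disc: for every `C^∞` almost
complex structure `J` on `ℝ⁴` with `J² = -1`, every `R₀` and every order `k` there is a constant
`C(J, R₀, k)` such that every globally `C^∞` map `g : ℂ → ℝ⁴` that is flat `J`-holomorphic on the
open disc `‖z‖ < 2` (`dg(z)(i ζ) = J(g z)(dg(z) ζ)`), bounded by `R₀` and with `‖dg‖ ≤ 2` on the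
closed unit disc satisfies `‖Dᵏ g(0)‖ ≤ C`. Then for maps `u n` (`n ∈ ℕ`) that are `C^∞` and flat
`J`-holomorphic on an open `U ⊆ ℂ` only, with `C⁰` and `C¹` bounds uniform in `n` on every compact
subset of `U`, all derivatives are bounded uniformly in `n` on every compact subset of `U`.

**Proof (cover, translate + rescale, cut off, apply the estimate at every centre).** Given a
compact `K ⊆ U` choose `δ > 0` with `K' := cthickening δ K ⊆ U` (`K'` is compact) and bounds
`‖u n‖ ≤ R`, `‖d(u n)‖ ≤ L` on `K'`; put `ρ := min (δ/3) (1/(L⁺+1))`, so `3ρ ≤ δ` and `ρ L ≤ 1`.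
For `z ∈ K` the rescaled map `f(ζ) = u n (z + ρ ζ)` is smooth near the closed disc of radius `3`
(which is mapped into `closedBall z (3ρ) ⊆ K' ⊆ U`); multiplying by a bump `χ` equal to `1` on
the closed disc of radius `2` and supported in the disc of radius `3` gives a globally smooth `g`
agreeing with `f` near every point of the open disc of radius `2`. There `dg(ζ) = ρ • d(u n)(z+ρζ)`
(chain rule), so `g` is flat `J`-holomorphic on `‖ζ‖ < 2`, `‖g‖ ≤ R` and `‖dg‖ ≤ ρ L ≤ 1 ≤ 2` on
the closed unit disc, whence `‖Dᵏ g(0)‖ ≤ C(J, R, k)`. Finally `Dᵏ g(0) = Dᵏ f(0)` is the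
composition of `Dᵏ (u n)(z)` with the dilation by `ρ` in every slot, so
`ρᵏ ‖Dᵏ (u n)(z)‖ ≤ ‖Dᵏ g(0)‖ ≤ C`, i.e. `‖Dᵏ (u n)(z)‖ ≤ C / ρᵏ` uniformly in `n` and `z ∈ K`.

Uses only Mathlib (`ContDiffBump`, `IsCompact.exists_cthickening_subset_open`,
`Metric.closedBall_subset_cthickening`, `Filter.EventuallyEq.iteratedFDeriv`,
`ContinuousLinearEquiv.iteratedFDerivWithin_comp_right`, `iteratedFDeriv_comp_add_left`,
`ContinuousMultilinearMap.opNorm_le_bound`).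
-/

noncomputable section

set_option linter.dupNamespace false

open scoped ContDiff Topology Nat
open Filter Set Metric

namespace Summit.SmoothPoincare4.SmoothPoincare4.Theorems.WitnessCharge.PencilIncompleteness

/-- Undoing a dilation by `ρ > 0` in every slot of a continuous `k`-multilinear map costs a factor
`ρ⁻¹` per slot: `ρᵏ ‖T‖ ≤ ‖T ∘ (e, …, e)‖` when `e ζ = ρ • ζ`. -/
theorem derivBoundsLocal_pow_mul_norm_le {k : ℕ}
    (T : ContinuousMultilinearMap ℝ (fun _ : Fin k => ℂ) (EuclideanSpace ℝ (Fin 4)))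
    (e : ℂ →L[ℝ] ℂ) {ρ : ℝ} (hρ : 0 < ρ) (he : ∀ ζ : ℂ, e ζ = ρ • ζ) :
    ρ ^ k * ‖T‖ ≤ ‖T.compContinuousLinearMap fun _ => e‖ := by
  rw [← le_div_iff₀' (pow_pos hρ k)]
  refine ContinuousMultilinearMap.opNorm_le_bound (by positivity) fun m => ?_
  have hm : T m = (T.compContinuousLinearMap fun _ => e) fun i => ρ⁻¹ • m i := by
    rw [ContinuousMultilinearMap.compContinuousLinearMap_apply]
    congr 1
    funext i
    rw [he, smul_smul, mul_inv_cancel₀ hρ.ne', one_smul]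
  have hprod : ∏ i : Fin k, ‖ρ⁻¹ • m i‖ = ρ⁻¹ ^ k * ∏ i, ‖m i‖ := by
    simp only [norm_smul, Real.norm_eq_abs, abs_inv, abs_of_pos hρ, Finset.prod_mul_distrib,
      Finset.prod_const, Finset.card_univ, Fintype.card_fin]
  calc ‖T m‖ = ‖(T.compContinuousLinearMap fun _ => e) fun i => ρ⁻¹ • m i‖ := by rw [hm]
    _ ≤ ‖T.compContinuousLinearMap fun _ => e‖ * ∏ i, ‖ρ⁻¹ • m i‖ :=
        ContinuousMultilinearMap.le_opNorm _ _
    _ = ‖T.compContinuousLinearMap fun _ => e‖ / ρ ^ k * ∏ i, ‖m i‖ := by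
        rw [hprod, inv_pow, div_eq_mul_inv, mul_assoc]

/-- Rescaling by `ρ > 0` at `z` multiplies the norm of the `k`-th derivative by at least `ρᵏ`:
`ρᵏ ‖Dᵏ v(z)‖ ≤ ‖Dᵏ (v(z + ρ ·))(0)‖` (no smoothness assumption is needed, the dilation being a
continuous linear equivalence). -/
theorem derivBoundsLocal_pow_mul_norm_iteratedFDeriv_le (v : ℂ → EuclideanSpace ℝ (Fin 4))
    (z : ℂ) {ρ : ℝ} (hρ : 0 < ρ) (k : ℕ) :
    ρ ^ k * ‖iteratedFDeriv ℝ k v z‖ ≤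
      ‖iteratedFDeriv ℝ k (fun ζ : ℂ => v (z + ρ • ζ)) 0‖ := by
  obtain ⟨e, he⟩ : ∃ e : ℂ ≃L[ℝ] ℂ, ∀ ζ : ℂ, e ζ = ρ • ζ :=
    ⟨ContinuousLinearEquiv.equivOfInverse (ρ • ContinuousLinearMap.id ℝ ℂ)
      (ρ⁻¹ • ContinuousLinearMap.id ℝ ℂ) (fun ζ => by simp [hρ.ne'])
      (fun ζ => by simp [hρ.ne']), fun ζ => rfl⟩
  have h1 : (fun ζ : ℂ => v (z + ρ • ζ)) = (fun w : ℂ => v (z + w)) ∘ e := by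
    funext ζ
    simp [he]
  have h2 := e.iteratedFDerivWithin_comp_right (fun w : ℂ => v (z + w)) uniqueDiffOn_univ
    (x := 0) (mem_univ _) k
  simp only [preimage_univ, iteratedFDerivWithin_univ, map_zero] at h2
  rw [h1, h2, iteratedFDeriv_comp_add_left, add_zero]
  exact derivBoundsLocal_pow_mul_norm_le _ _ hρ he

/-- The affine pull-back `ζ ↦ v (z + ρ ζ)` of a map `C^∞` on an open `U` is `C^∞` at every `ζ`
with `z + ρ ζ ∈ U`. -/
theorem derivBoundsLocal_contDiffAt_affine {U : Set ℂ} (hU : IsOpen U)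
    {v : ℂ → EuclideanSpace ℝ (Fin 4)}
    (hv : ContDiffOn ℝ ∞ v U) (z : ℂ) (ρ : ℝ) {ζ : ℂ} (hζ : z + ρ • ζ ∈ U) :
    ContDiffAt ℝ ∞ (fun w : ℂ => v (z + ρ • w)) ζ := by
  have h1 : ContDiffAt ℝ ∞ (fun w : ℂ => z + ρ • w) ζ :=
    contDiffAt_const.add (contDiffAt_id.const_smul ρ)
  exact (hv.contDiffAt (hU.mem_nhds hζ)).comp ζ h1

/-- Chain rule for the affine pull-back: `d(v(z + ρ ·))(ζ) = d v(z + ρ ζ) ∘ (ρ • id)` whenever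
`v` is `C^∞` on an open `U ∋ z + ρ ζ`. -/
theorem derivBoundsLocal_fderiv_affine {U : Set ℂ} (hU : IsOpen U)
    {v : ℂ → EuclideanSpace ℝ (Fin 4)}
    (hv : ContDiffOn ℝ ∞ v U) (z : ℂ) (ρ : ℝ) {ζ : ℂ} (hζ : z + ρ • ζ ∈ U) :
    fderiv ℝ (fun w : ℂ => v (z + ρ • w)) ζ =
      (fderiv ℝ v (z + ρ • ζ)).comp (ρ • ContinuousLinearMap.id ℝ ℂ) := by
  have hd : DifferentiableAt ℝ v (z + ρ • ζ) :=
    (hv.contDiffAt (hU.mem_nhds hζ)).differentiableAt (by simp)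
  have haff : HasFDerivAt (fun w : ℂ => z + ρ • w) (ρ • ContinuousLinearMap.id ℝ ℂ) ζ :=
    ((ρ • ContinuousLinearMap.id ℝ ℂ).hasFDerivAt).const_add z
  exact (hd.hasFDerivAt.comp ζ haff).fderiv

/-- Cutting off by a bump function: if `f` is `C^∞` at every point of the closed ball
`closedBall 0 χ.rOut ⊇ tsupport χ`, then `χ • f` is globally `C^∞`. -/
theorem derivBoundsLocal_contDiff_bump_smul (χ : ContDiffBump (0 : ℂ))
    {f : ℂ → EuclideanSpace ℝ (Fin 4)}
    (hf : ∀ ζ ∈ closedBall (0 : ℂ) χ.rOut, ContDiffAt ℝ ∞ f ζ) :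
    ContDiff ℝ ∞ fun ζ => χ ζ • f ζ := by
  refine contDiff_iff_contDiffAt.2 fun ζ => ?_
  by_cases hζ : ζ ∈ tsupport χ
  · rw [χ.tsupport_eq] at hζ
    exact χ.contDiffAt.smul (hf ζ hζ)
  · rw [notMem_tsupport_iff_eventuallyEq] at hζ
    have h0 : (fun ζ => χ ζ • f ζ) =ᶠ[𝓝 ζ] fun _ => 0 := by
      filter_upwards [hζ] with w hw
      simp [hw]
    exact contDiffAt_const.congr_of_eventuallyEq h0

/-- **Rescaling + cut-off at one centre.** For `v` `C^∞` and flat `J`-holomorphic on an open `U`,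
a centre `z` and a scale `ρ > 0` with `closedBall z (3ρ) ⊆ U`, `‖v‖ ≤ R` and `‖dv‖ ≤ L` on that
ball and `ρ L ≤ 1`, there is a globally `C^∞` map `g` (namely `χ • v(z + ρ ·)`), flat
`J`-holomorphic on `‖ζ‖ < 2`, with `‖g‖ ≤ R` and `‖dg‖ ≤ 2` on the closed unit disc, and
`ρᵏ ‖Dᵏ v(z)‖ ≤ ‖Dᵏ g(0)‖` for every `k`. -/
theorem derivBoundsLocal_rescale
    (J : EuclideanSpace ℝ (Fin 4) → EuclideanSpace ℝ (Fin 4) →L[ℝ] EuclideanSpace ℝ (Fin 4))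
    {U : Set ℂ} (hU : IsOpen U)
    {v : ℂ → EuclideanSpace ℝ (Fin 4)} (hv : ContDiffOn ℝ ∞ v U)
    (hvJ : ∀ p ∈ U, ∀ w : ℂ, fderiv ℝ v p (Complex.I * w) = J (v p) (fderiv ℝ v p w))
    (z : ℂ) {ρ R L : ℝ} (hρ : 0 < ρ) (hρL : ρ * L ≤ 1) (hsub : closedBall z (3 * ρ) ⊆ U)
    (hR : ∀ p ∈ closedBall z (3 * ρ), ‖v p‖ ≤ R)
    (hL : ∀ p ∈ closedBall z (3 * ρ), ‖fderiv ℝ v p‖ ≤ L) :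
    ∃ g : ℂ → EuclideanSpace ℝ (Fin 4), ContDiff ℝ ∞ g ∧
      (∀ ζ : ℂ, ‖ζ‖ < 2 → ∀ w : ℂ, fderiv ℝ g ζ (Complex.I * w) = J (g ζ) (fderiv ℝ g ζ w)) ∧
      (∀ ζ : ℂ, ‖ζ‖ ≤ 1 → ‖g ζ‖ ≤ R) ∧ (∀ ζ : ℂ, ‖ζ‖ ≤ 1 → ‖fderiv ℝ g ζ‖ ≤ 2) ∧
      ∀ k : ℕ, ρ ^ k * ‖iteratedFDeriv ℝ k v z‖ ≤ ‖iteratedFDeriv ℝ k g 0‖ := by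
  obtain ⟨χ, hχIn, hχOut⟩ : ∃ χ : ContDiffBump (0 : ℂ), χ.rIn = 2 ∧ χ.rOut = 3 :=
    ⟨⟨2, 3, by norm_num, by norm_num⟩, rfl, rfl⟩
  -- the closed disc of radius `3` is mapped into `closedBall z (3ρ)`
  have hmem : ∀ ζ : ℂ, ‖ζ‖ ≤ 3 → z + ρ • ζ ∈ closedBall z (3 * ρ) := by
    intro ζ hζ
    rw [mem_closedBall, dist_self_add_left, norm_smul, Real.norm_eq_abs, abs_of_pos hρ]
    nlinarith
  -- `χ = 1` near every point of the open disc of radius `2`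
  have hgf : ∀ ζ : ℂ, ‖ζ‖ < 2 →
      (fun ζ => χ ζ • v (z + ρ • ζ)) =ᶠ[𝓝 ζ] fun ζ => v (z + ρ • ζ) := by
    intro ζ hζ
    have h1 : (χ : ℂ → ℝ) =ᶠ[𝓝 ζ] 1 :=
      χ.eventuallyEq_one_of_mem_ball (by rw [hχIn, mem_ball_zero_iff]; exact hζ)
    filter_upwards [h1] with w hw
    simp [hw]
  have hχ1 : ∀ ζ : ℂ, ‖ζ‖ ≤ 2 → χ ζ = 1 := fun ζ hζ =>
    χ.one_of_mem_closedBall (by rw [hχIn, mem_closedBall_zero_iff]; exact hζ)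
  refine ⟨fun ζ => χ ζ • v (z + ρ • ζ), ?_, ?_, ?_, ?_, ?_⟩
  · -- global smoothness
    refine derivBoundsLocal_contDiff_bump_smul χ fun ζ hζ => ?_
    rw [hχOut, mem_closedBall_zero_iff] at hζ
    exact derivBoundsLocal_contDiffAt_affine hU hv z ρ (hsub (hmem ζ hζ))
  · -- the equation on the open disc of radius `2`
    intro ζ hζ w
    have hp : z + ρ • ζ ∈ U := hsub (hmem ζ (by linarith))
    rw [(hgf ζ hζ).fderiv_eq, derivBoundsLocal_fderiv_affine hU hv z ρ hp]
    simp only [hχ1 ζ hζ.le, one_smul, ContinuousLinearMap.comp_apply, smul_apply,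
      ContinuousLinearMap.id_apply]
    rw [← mul_smul_comm]
    exact hvJ _ hp _
  · -- `C⁰` bound on the closed unit disc
    intro ζ hζ
    simp only [hχ1 ζ (by linarith), one_smul]
    exact hR _ (hmem ζ (by linarith))
  · -- gradient bound on the closed unit disc
    intro ζ hζ
    have hp : z + ρ • ζ ∈ closedBall z (3 * ρ) := hmem ζ (by linarith)
    rw [(hgf ζ (by linarith)).fderiv_eq, derivBoundsLocal_fderiv_affine hU hv z ρ (hsub hp)]
    have hid : ‖ρ • ContinuousLinearMap.id ℝ ℂ‖ ≤ ρ := by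
      rw [norm_smul, Real.norm_eq_abs, abs_of_pos hρ]
      exact mul_le_of_le_one_right hρ.le ContinuousLinearMap.norm_id_le
    have hL0 : 0 ≤ L := (norm_nonneg _).trans (hL _ hp)
    calc ‖(fderiv ℝ v (z + ρ • ζ)).comp (ρ • ContinuousLinearMap.id ℝ ℂ)‖
        ≤ ‖fderiv ℝ v (z + ρ • ζ)‖ * ‖ρ • ContinuousLinearMap.id ℝ ℂ‖ :=
          ContinuousLinearMap.opNorm_comp_le _ _
      _ ≤ L * ρ := mul_le_mul (hL _ hp) hid (norm_nonneg _) hL0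
      _ ≤ 2 := by rw [mul_comm]; linarith
  · -- comparison of the `k`-th derivatives at the centre
    intro k
    rw [((hgf 0 (by simp)).iteratedFDeriv ℝ k).eq_of_nhds]
    exact derivBoundsLocal_pow_mul_norm_iteratedFDeriv_le v z hρ k

/-- **Stub A4 (derivative bounds on compact subsets from the local a priori estimate).**
Flat `J`-holomorphic maps on an open `U` with `C⁰` and `C¹` bounds uniform in `n` on compact
subsets of `U` have all derivatives bounded uniformly in `n` on compact subsets of `U`
(cover, rescale to the unit disc, cut off, apply the local a priori estimate at every centre). -/
theorem helper_derivBoundsLocal_of :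
    (∀ (J : EuclideanSpace ℝ (Fin 4) → EuclideanSpace ℝ (Fin 4) →L[ℝ] EuclideanSpace ℝ (Fin 4)),
      ContDiff ℝ ∞ J → (∀ x v, J x (J x v) = -v) → ∀ (R₀ : ℝ) (k : ℕ),
    ∃ C : ℝ, ∀ g : ℂ → EuclideanSpace ℝ (Fin 4), ContDiff ℝ ∞ g →
      (∀ z : ℂ, ‖z‖ < 2 → ∀ ζ : ℂ, fderiv ℝ g z (Complex.I * ζ) = J (g z) (fderiv ℝ g z ζ)) →
      (∀ z : ℂ, ‖z‖ ≤ 1 → ‖g z‖ ≤ R₀) → (∀ z : ℂ, ‖z‖ ≤ 1 → ‖fderiv ℝ g z‖ ≤ 2) →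
      ‖iteratedFDeriv ℝ k g 0‖ ≤ C) →
    ∀ (J : EuclideanSpace ℝ (Fin 4) → EuclideanSpace ℝ (Fin 4) →L[ℝ] EuclideanSpace ℝ (Fin 4)),
      ContDiff ℝ ∞ J → (∀ x v, J x (J x v) = -v) →
    ∀ (U : Set ℂ), IsOpen U → ∀ (u : ℕ → ℂ → EuclideanSpace ℝ (Fin 4)),
      (∀ n, ContDiffOn ℝ ∞ (u n) U) →
      (∀ n, ∀ z ∈ U, ∀ ζ : ℂ, fderiv ℝ (u n) z (Complex.I * ζ) = J (u n z) (fderiv ℝ (u n) z ζ)) →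
      (∀ K : Set ℂ, IsCompact K → K ⊆ U → ∃ R : ℝ, ∀ n, ∀ z ∈ K, ‖u n z‖ ≤ R) →
      (∀ K : Set ℂ, IsCompact K → K ⊆ U → ∃ L : ℝ, ∀ n, ∀ z ∈ K, ‖fderiv ℝ (u n) z‖ ≤ L) →
      ∀ (k : ℕ) (K : Set ℂ), IsCompact K → K ⊆ U →
        ∃ C : ℝ, ∀ n, ∀ z ∈ K, ‖iteratedFDeriv ℝ k (u n) z‖ ≤ C := by
  intro hA J hJs hJ2 U hU u hu huJ hC0 hC1 k K hK hKU
  -- (1) room: a compact closed thickening `K'` of `K` inside `U`, with `C⁰`/`C¹` bounds on it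
  obtain ⟨δ, hδ, hδU⟩ := hK.exists_cthickening_subset_open hU hKU
  obtain ⟨R, hR⟩ := hC0 (cthickening δ K) hK.cthickening hδU
  obtain ⟨L, hL⟩ := hC1 (cthickening δ K) hK.cthickening hδU
  obtain ⟨L', hLL', hL'0⟩ : ∃ L' : ℝ, L ≤ L' ∧ 0 ≤ L' :=
    ⟨max L 0, le_max_left _ _, le_max_right _ _⟩
  -- (2) the scale
  obtain ⟨ρ, hρ, h3ρ, hρL⟩ : ∃ ρ : ℝ, 0 < ρ ∧ 3 * ρ ≤ δ ∧ ρ * L' ≤ 1 := by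
    refine ⟨min (δ / 3) (1 / (L' + 1)), lt_min (by positivity) (by positivity), ?_, ?_⟩
    · linarith [min_le_left (δ / 3) (1 / (L' + 1))]
    · calc min (δ / 3) (1 / (L' + 1)) * L' ≤ 1 / (L' + 1) * L' :=
            mul_le_mul_of_nonneg_right (min_le_right _ _) hL'0
        _ ≤ 1 := by
            rw [div_mul_eq_mul_div, one_mul, div_le_one (by positivity)]
            linarith
  -- (3) the a priori constant, uniform in the centre and in `n`
  obtain ⟨C, hC⟩ := hA J hJs hJ2 R k
  refine ⟨C / ρ ^ k, fun n z hz => ?_⟩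
  have hsub : closedBall z (3 * ρ) ⊆ cthickening δ K :=
    (closedBall_subset_closedBall h3ρ).trans (closedBall_subset_cthickening hz δ)
  obtain ⟨g, hg, hgJ, hgR, hgd, hgk⟩ := derivBoundsLocal_rescale J hU (hu n) (huJ n) z hρ hρL
    (hsub.trans hδU) (fun p hp => hR n p (hsub hp)) (fun p hp => (hL n p (hsub hp)).trans hLL')
  rw [le_div_iff₀ (pow_pos hρ k), mul_comm]
  exact (hgk k).trans (hC g hg hgJ hgR hgd)

end Summit.SmoothPoincare4.SmoothPoincare4.Theorems.WitnessCharge.PencilIncompleteness
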